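import Literature.NumberTheory.Transcendental.KZMellinFibres
import Literature.NumberTheory.Transcendental.KZSemialgebraicComplex
import Literature.NumberTheory.Transcendental.SemialgebraicMapsProofs
import HarnessLib

/-!
# Rational powers and finite products of real semialgebraic functions

Folklore closure properties of `ℚ`-semialgebraic functions (Bochnak–Coste–Roy 1998, Prop. 2.2.6,
§2.2) that the Kontsevich–Zagier calculus uses whenever an integrand is an "algebraic function
with algebraic coefficients" written with real powers `x ↦ x^e`, `e ∈ ℚ` (Kontsevich–Zagier 2001,
§1.1): Euler–Beta kernels `t^{a-1}(1-t)^{b-1}`, hypergeometric Euler kernels `(1 − λt)^{−a}` with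
`λ` real algebraic, elliptic kernels. Everything is proved; no definition is introduced.

* `isSemialgebraicFunOn_rpow_apply_ratCast` — `y ↦ yᵢ^e` on `{y | 0 < yᵢ} ⊆ ℝᵐ`
  (one-factor case of `KZ.isSemialgebraicFunOn_mellinIntegrand`: graph `{w > 0, w^q yᵢ^{p⁻} = yᵢ^{p⁺}}`);
* `IsSemialgebraicFunOn.rpow_ratCast` — `x ↦ (f x)^e` for `f` semialgebraic and POSITIVE on `s`
  (composition with the semialgebraic map `x ↦ (f x)`, Tarski–Seidenberg via
  `IsSemialgebraicFunOn.comp_isSemialgebraicMapOn_holds`);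
* `IsSemialgebraicFunOn.rpow_ratCast_of_nonneg` — the same for `f ≥ 0` on `s` and `e ≠ 0`
  (Mathlib's `0 ^ e = 0`: split `s` into `{f > 0}` and `{f = 0}`);
* `IsSemialgebraicFunOn.finset_prod` — finite products (finite sums: `IsSemialgebraicFunOn.finset_sum`
  in `KZRegCalculus.lean`).

References: J. Bochnak, M. Coste, M.-F. Roy, *Real Algebraic Geometry* (1998), Prop. 2.2.6;
M. Kontsevich, D. Zagier, *Periods* (2001), §1.1.
-/

noncomputable section

open Set MvPolynomial
open Literature.ModelTheory.ExponentialFields (IsSemialgebraic isSemialgebraic_setOf_eval_pos)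

namespace Literature.NumberTheory.Transcendental

variable {m : ℕ}

/-- `y ↦ yᵢ^e` (`e ∈ ℚ`) is `ℚ`-semialgebraic on `{y | 0 < yᵢ} ⊆ ℝᵐ` (one-factor Euler–Mellin
monomial, `KZ.isSemialgebraicFunOn_mellinIntegrand`). [cite: BochnakCosteRoy1998, Prop. 2.2.6] -/
theorem isSemialgebraicFunOn_rpow_apply_ratCast (i : Fin m) (e : ℚ) :
    IsSemialgebraicFunOn ℚ {y : Fin m → ℝ | 0 < y i} (fun y => (y i) ^ ((e : ℚ) : ℝ)) := by
  have hT : IsSemialgebraic ℚ {y : Fin m → ℝ | 0 < y i} := by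
    simpa using isSemialgebraic_setOf_eval_pos (k := ℚ) (R := ℝ) (X i : MvPolynomial (Fin m) ℚ)
  refine (KZ.isSemialgebraicFunOn_mellinIntegrand hT ![X i] ![e] 1 fun y hy k => ?_).congr
    fun y _ => ?_
  · have hy' : 0 < y i := hy
    fin_cases k
    simpa using hy'
  · simp [KZ.mellinIntegrand_apply]

namespace IsSemialgebraicFunOn

variable {s : Set (Fin m → ℝ)} {f : (Fin m → ℝ) → ℝ}

/-- **Rational powers of positive semialgebraic functions**: if `f` is `ℚ`-semialgebraic and
positive on the `ℚ`-semialgebraic set `s`, then so is `x ↦ (f x)^e` for every `e ∈ ℚ`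
(composite of `y ↦ y₀^e` with the semialgebraic map `x ↦ (f x)`). [cite: BochnakCosteRoy1998, Prop. 2.2.6] -/
theorem rpow_ratCast (hs : IsSemialgebraic ℚ s) (hf : IsSemialgebraicFunOn ℚ s f)
    (hpos : ∀ x ∈ s, 0 < f x) (e : ℚ) :
    IsSemialgebraicFunOn ℚ s (fun x => f x ^ ((e : ℚ) : ℝ)) := by
  have hF : IsSemialgebraicMapOn ℚ s (fun x : Fin m → ℝ => fun _ : Fin 1 => f x) :=
    IsSemialgebraicMapOn.of_forall hs fun _ => hf
  have hmaps : MapsTo (fun x : Fin m → ℝ => fun _ : Fin 1 => f x) s {y : Fin 1 → ℝ | 0 < y 0} :=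
    fun x hx => hpos x hx
  exact (IsSemialgebraicFunOn.comp_isSemialgebraicMapOn_holds
    (isSemialgebraicFunOn_rpow_apply_ratCast (0 : Fin 1) e) hF hmaps).congr fun x _ => rfl

/-- Rational powers with NON-ZERO exponent of non-negative semialgebraic functions are
semialgebraic (with Mathlib's convention `0 ^ e = 0` for `e ≠ 0`): split `s` into `{f > 0}`, where
`rpow_ratCast` applies, and `{f = 0}`, where the function vanishes. [cite: BochnakCosteRoy1998, Prop. 2.2.6] -/
theorem rpow_ratCast_of_nonneg (hf : IsSemialgebraicFunOn ℚ s f)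
    (hnn : ∀ x ∈ s, 0 ≤ f x) {e : ℚ} (he : e ≠ 0) :
    IsSemialgebraicFunOn ℚ s (fun x => f x ^ ((e : ℚ) : ℝ)) := by
  -- the two pieces
  have hP : IsSemialgebraic ℚ {x | x ∈ s ∧ (-f) x < 0} := hf.neg.isSemialgebraic_sep_neg
  have hZ : IsSemialgebraic ℚ ({x | x ∈ s ∧ 0 ≤ f x} ∩ {x | x ∈ s ∧ 0 ≤ (-f) x}) :=
    hf.isSemialgebraic_sep_nonneg.inter hf.neg.isSemialgebraic_sep_nonneg
  have hPs : {x | x ∈ s ∧ (-f) x < 0} ⊆ s := fun _ hx => hx.1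
  have hZs : {x | x ∈ s ∧ 0 ≤ f x} ∩ {x | x ∈ s ∧ 0 ≤ (-f) x} ⊆ s := fun _ hx => hx.1.1
  have hposP : ∀ x ∈ {x | x ∈ s ∧ (-f) x < 0}, 0 < f x := fun x hx => by
    have h : -f x < 0 := hx.2
    linarith
  have hzero : ∀ x ∈ {x | x ∈ s ∧ 0 ≤ f x} ∩ {x | x ∈ s ∧ 0 ≤ (-f) x}, f x = 0 := fun x hx => by
    have h1 : 0 ≤ f x := hx.1.2
    have h2 : 0 ≤ -f x := hx.2.2
    linarith
  have h1 : IsSemialgebraicFunOn ℚ {x | x ∈ s ∧ (-f) x < 0} (fun x => f x ^ ((e : ℚ) : ℝ)) :=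
    rpow_ratCast hP (hf.mono hPs hP) hposP e
  have h2 : IsSemialgebraicFunOn ℚ ({x | x ∈ s ∧ 0 ≤ f x} ∩ {x | x ∈ s ∧ 0 ≤ (-f) x})
      (fun _ => (0:ℝ)) :=
    (isSemialgebraicFunOn_aeval hZ (0 : MvPolynomial (Fin m) ℚ)).congr fun x _ => by simp
  have hcover : s = {x | x ∈ s ∧ (-f) x < 0} ∪
      ({x | x ∈ s ∧ 0 ≤ f x} ∩ {x | x ∈ s ∧ 0 ≤ (-f) x}) := by
    ext x
    simp only [mem_union, mem_inter_iff, mem_setOf_eq, Pi.neg_apply, neg_lt_zero, neg_nonneg]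
    constructor
    · intro hx
      rcases (hnn x hx).lt_or_eq with h | h
      · exact Or.inl ⟨hx, h⟩
      · exact Or.inr ⟨⟨hx, h.le⟩, hx, h.ge⟩
    · rintro (⟨hx, _⟩ | ⟨⟨hx, _⟩, _⟩) <;> exact hx
  rw [hcover]
  refine h1.union h2 (fun _ _ => rfl) fun x hx => ?_
  have he' : ((e : ℚ) : ℝ) ≠ 0 := by exact_mod_cast he
  simp only [hzero x hx, Real.zero_rpow he']

/-- Finite products of semialgebraic functions are semialgebraic. [cite: BochnakCosteRoy1998, Prop. 2.2.6] -/
theorem finset_prod {ι : Type*} (hs : IsSemialgebraic ℚ s) (t : Finset ι)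
    {F : ι → (Fin m → ℝ) → ℝ} (hF : ∀ i ∈ t, IsSemialgebraicFunOn ℚ s (F i)) :
    IsSemialgebraicFunOn ℚ s (fun x => ∏ i ∈ t, F i x) := by
  classical
  induction t using Finset.induction_on with
  | empty =>
    exact (isSemialgebraicFunOn_aeval hs (1 : MvPolynomial (Fin m) ℚ)).congr fun x _ => by simp
  | insert a t ha ih =>
    have h := IsSemialgebraicFunOn.mul_holds (hF a (Finset.mem_insert_self a t))
      (ih fun i hi => hF i (Finset.mem_insert_of_mem hi))
    refine h.congr fun x _ => ?_
    simp [Finset.prod_insert ha]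

end IsSemialgebraicFunOn

end Literature.NumberTheory.Transcendental
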